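import Mathlib
import HarnessLib
import Summits.ValiantsHypothesis.ValiantsHypothesis.Theorems.LacunarySymmetroidMatrixDescartesProductPlusOnePivotWindow

/-!
# ValiantsHypothesis / LacunarySymmetroid — crux `MatrixDescartes` (stmt-ValiantsHypothesis-18050, V1),
# LINE (A) «product_plus_one»: the INVERSION LAW — where the every-`K` residue lives

Contrapositive packaging of ✓ `eulerNumeratorK_roots_Icc_le_one_of_pivot` (`…ProductPlusOnePivotWindow`) that needs NO pivot to be named.
Setting as there (ANY `K`, ANY support, every coupling `l₀`, split-signed rows, a window `[u,v] ⊂ (0,∞)` of constant row signs, letter-fraction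
sums `A_l(x) = Σ_j a_{jl}·x^{d_{l₀}}/f_j(x)`).  Say letter `l` (off the coupled exponent) is AHEAD-DOMINATED at `x` when `A_l(x)` has the sign an
ahead row gives it (`> 0` for `d_l < d_{l₀}`, `< 0` for `d_l > d_{l₀}`).  Because `A_l` is isotone for lower and antitone for upper letters
(✓ `inv_row_monotone_of_splitSigned`), along a window every letter passes from passed-dominated to ahead-dominated AT MOST ONCE and never back.

* ★★★ `eulerNumeratorK_roots_Icc_le_one_of_noInversion` — THE INVERSION LAW: if the letter sums do not vanish at the two ends of the window
  and there is NO INVERSION across it — whenever a letter of SMALLER exponent is ahead-dominated at the right end `v`, every letter of LARGER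
  exponent is already ahead-dominated at the left end `u` — then `R_{l₀}` has at most one zero in `[u,v]`.  (Proof: the letter of least exponent
  among those ahead-dominated at `v` — or the top letter if there is none — is an admissible pivot on the whole window.)  Contrapositive: between
  two zeros of the c-free Euler numerator on a pole-free stretch, some LOWER-exponent letter becomes ahead-dominated before some HIGHER-exponent
  letter does — the every-`K`, every-coupling form of the `K = 3` «type α» (`A₁ < 0 < A₂` at the bottom coupling, ✓ `letterSums_opposite_of_euler_zero`).

HONEST FRAMING: bookkeeping on top of the pivot window law; the count inside inversion windows is the research residue and is NOT touched; closes NO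
stub by name; NOT `OneChangeFloorK3`, `EulerBoundK3`, `ClassRowK3Linear`, `PPOPolyLaw`, `ProductPlusOneMDR`, `MatrixDescartes`; `VP ≠ VNP` is NOT
proved.  No definitions, no named facts, no sorry.

[folklore] Elementary; no citation needed.
-/

set_option linter.dupNamespace false

namespace Summit.ValiantsHypothesis.ValiantsHypothesis.Theorems.LacunarySymmetroidMatrixDescartes

namespace ProductPlusOne

open Polynomial Finset
open scoped BigOperators

/-- ★★★ **THE INVERSION LAW** (every `K`, any support, every coupling).  Split-signed rows; constant-sign window `[u,v] ⊂ (0,∞)`; two letters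
off the coupled exponent with distinct exponents; no letter sum vanishes at `u` or at `v`; and NO INVERSION across the window: for letters
`l, l'` off the coupled exponent with `d_l < d_{l'}`, if `l` is ahead-dominated at `v` then `l'` is ahead-dominated at `u`.  Then the c-free Euler
numerator `R_{l₀}` has at most one zero in `[u,v]`. [this file's theorem] -/
theorem eulerNumeratorK_roots_Icc_le_one_of_noInversion {m K : ℕ} (d : Fin K → ℕ) (a : Fin m → Fin K → ℝ) (l₀ : Fin K)
    (hlow : ∀ j l, d l < d l₀ → 0 ≤ a j l) (hup : ∀ j l, d l₀ < d l → a j l ≤ 0)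
    {u v : ℝ} (hu : 0 < u) (huv : u ≤ v)
    (hsign : ∀ j, (∀ x ∈ Set.Icc u v, 0 < (∑ l, C (a j l) * X ^ (d l) : ℝ[X]).eval x) ∨
      (∀ x ∈ Set.Icc u v, (∑ l, C (a j l) * X ^ (d l) : ℝ[X]).eval x < 0))
    (hK : ∃ l l', d l ≠ d l₀ ∧ d l' ≠ d l₀ ∧ d l ≠ d l')
    (hnz : ∀ l, d l ≠ d l₀ →
      (∑ j, a j l * (u ^ (d l₀) / (∑ l', C (a j l') * X ^ (d l') : ℝ[X]).eval u)) ≠ 0 ∧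
      (∑ j, a j l * (v ^ (d l₀) / (∑ l', C (a j l') * X ^ (d l') : ℝ[X]).eval v)) ≠ 0)
    (hnoinv : ∀ l l', d l < d l' → d l ≠ d l₀ → d l' ≠ d l₀ →
      ((d l < d l₀ → 0 < ∑ j, a j l * (v ^ (d l₀) / (∑ l'', C (a j l'') * X ^ (d l'') : ℝ[X]).eval v)) ∧
        (d l₀ < d l → ∑ j, a j l * (v ^ (d l₀) / (∑ l'', C (a j l'') * X ^ (d l'') : ℝ[X]).eval v) < 0)) →
      ((d l' < d l₀ → 0 < ∑ j, a j l' * (u ^ (d l₀) / (∑ l'', C (a j l'') * X ^ (d l'') : ℝ[X]).eval u)) ∧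
        (d l₀ < d l' → ∑ j, a j l' * (u ^ (d l₀) / (∑ l'', C (a j l'') * X ^ (d l'') : ℝ[X]).eval u) < 0))) :
    ((∑ j, (∑ l, C (a j l * ((d l : ℝ) - d l₀)) * X ^ (d l)) * ∏ i ∈ Finset.univ.erase j, (∑ l, C (a i l) * X ^ (d l))
        : ℝ[X]).roots.toFinset.filter (fun t => u ≤ t ∧ t ≤ v)).card ≤ 1 := by
  classical
  set f : Fin m → ℝ[X] := fun j => ∑ l, C (a j l) * X ^ (d l) with hf
  set A : Fin K → ℝ → ℝ := fun l x => ∑ j, a j l * (x ^ (d l₀) / (f j).eval x) with hAdef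
  -- «ahead-dominated at x»
  set AD : Fin K → ℝ → Prop := fun l x => (d l < d l₀ → 0 < A l x) ∧ (d l₀ < d l → A l x < 0) with hAD
  have huI : u ∈ Set.Icc u v := ⟨le_rfl, huv⟩
  have hvI : v ∈ Set.Icc u v := ⟨huv, le_rfl⟩
  -- monotonicity of the letter sums on the window
  have hTmono : ∀ j, MonotoneOn (fun x => x ^ (d l₀) / (f j).eval x) (Set.Icc u v) := fun j =>
    inv_row_monotone_of_splitSigned d (a j) l₀ (hlow j) (hup j) hu (hsign j)
  have hAlow : ∀ l, d l < d l₀ → MonotoneOn (A l) (Set.Icc u v) := by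
    intro l hl x hx y hy hxy
    exact Finset.sum_le_sum fun j _ => mul_le_mul_of_nonneg_left (hTmono j hx hy hxy) (hlow j l hl)
  have hAup : ∀ l, d l₀ < d l → AntitoneOn (A l) (Set.Icc u v) := by
    intro l hl x hx y hy hxy
    exact Finset.sum_le_sum fun j _ => mul_le_mul_of_nonpos_left (hTmono j hx hy hxy) (hup j l hl)
  -- ahead-dominated at `u` ⇒ ahead-dominated (strictly) on the whole window
  have hA_of_u : ∀ l, d l ≠ d l₀ → AD l u → ∀ x ∈ Set.Icc u v, AD l x := by
    intro l hl0 hADu x hx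
    refine ⟨fun hl => ?_, fun hl => ?_⟩
    · exact lt_of_lt_of_le (hADu.1 hl) (hAlow l hl huI hx hx.1)
    · exact lt_of_le_of_lt (hAup l hl huI hx hx.1) (hADu.2 hl)
  -- NOT ahead-dominated at `v` (and non-vanishing there) ⇒ passed-dominated (strictly) on the whole window
  have hP_of_v : ∀ l, d l ≠ d l₀ → ¬ AD l v → ∀ x ∈ Set.Icc u v,
      (d l < d l₀ → A l x < 0) ∧ (d l₀ < d l → 0 < A l x) := by
    intro l hl0 hnot x hx
    have hnzv : A l v ≠ 0 := (hnz l hl0).2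
    refine ⟨fun hl => ?_, fun hl => ?_⟩
    · -- lower letter: `¬ (0 < A l v)` with `A l v ≠ 0` gives `A l v < 0`; isotone ⇒ `A l x ≤ A l v`
      have hv : ¬ 0 < A l v := fun h => hnot ⟨fun _ => h, fun h' => absurd (hl.trans h') (lt_irrefl _)⟩
      have hv' : A l v < 0 := lt_of_le_of_ne (not_lt.mp hv) hnzv
      exact lt_of_le_of_lt (hAlow l hl hx hvI hx.2) hv'
    · have hv : ¬ A l v < 0 := fun h => hnot ⟨fun h' => absurd (h'.trans hl) (lt_irrefl _), fun _ => h⟩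
      have hv' : 0 < A l v := lt_of_le_of_ne (not_lt.mp hv) hnzv.symm
      exact lt_of_lt_of_le hv' (hAup l hl hx hvI hx.2)
  -- choose the pivot
  obtain ⟨l₁, l₂, hl₁, hl₂, hl₁₂⟩ := hK
  set Sv := (Finset.univ : Finset (Fin K)).filter (fun l => d l ≠ d l₀ ∧ AD l v) with hSv
  -- the pivot and its two properties: letters above it are ahead-dominated at `u`, letters below it are not ahead-dominated at `v`
  obtain ⟨lp, hlp_above, hlp_below⟩ : ∃ lp : Fin K,
      (∀ l, d lp < d l → d l ≠ d l₀ → AD l u) ∧ (∀ l, d l < d lp → d l ≠ d l₀ → ¬ AD l v) := by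
    by_cases hne : Sv.Nonempty
    · obtain ⟨lp, hlpS, hmin⟩ := Finset.exists_min_image Sv (fun l => d l) hne
      have hlpS' := (Finset.mem_filter.mp hlpS).2
      refine ⟨lp, fun l hl hl0 => ?_, fun l hl hl0 hADl => ?_⟩
      · exact hnoinv lp l hl hlpS'.1 hl0 hlpS'.2
      · have := hmin l (Finset.mem_filter.mpr ⟨Finset.mem_univ l, hl0, hADl⟩)
        exact absurd hl (not_lt.mpr this)
    · -- nobody is ahead-dominated at `v`: pivot = a letter of maximal exponent among the letters off the coupled exponent
      have hne' : ((Finset.univ : Finset (Fin K)).filter (fun l => d l ≠ d l₀)).Nonempty :=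
        ⟨l₁, Finset.mem_filter.mpr ⟨Finset.mem_univ l₁, hl₁⟩⟩
      obtain ⟨lp, hlpS, hmax⟩ := Finset.exists_max_image _ (fun l => d l) hne'
      refine ⟨lp, fun l hl hl0 => ?_, fun l hl hl0 hADl => ?_⟩
      · have := hmax l (Finset.mem_filter.mpr ⟨Finset.mem_univ l, hl0⟩)
        exact absurd hl (not_lt.mpr this)
      · exact hne ⟨l, Finset.mem_filter.mpr ⟨Finset.mem_univ l, hl0, hADl⟩⟩
  -- some letter sits off both the pivot exponent and the coupled exponent
  have hex : ∃ l, d l ≠ d lp ∧ d l ≠ d l₀ := by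
    by_cases h1 : d l₁ = d lp
    · exact ⟨l₂, fun h => hl₁₂ (h1.trans h.symm), hl₂⟩
    · exact ⟨l₁, h1, hl₁⟩
  -- apply the pivot window law
  refine eulerNumeratorK_roots_Icc_le_one_of_pivot d a l₀ lp hlow hup hu hsign ?_ ?_ hex
  · intro x hx l hl
    by_cases hl0 : d l = d l₀
    · refine ⟨fun h => absurd hl0 h.ne, fun h => absurd hl0.symm h.ne⟩
    · exact hA_of_u l hl0 (hlp_above l hl hl0) x hx
  · intro x hx l hl
    by_cases hl0 : d l = d l₀
    · refine ⟨fun h => absurd hl0 h.ne, fun h => absurd hl0.symm h.ne⟩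
    · exact hP_of_v l hl0 (hlp_below l hl hl0) x hx

end ProductPlusOne

end Summit.ValiantsHypothesis.ValiantsHypothesis.Theorems.LacunarySymmetroidMatrixDescartes
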